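import Summits.HodgeConjecture.HodgeConjecture.Theorems.R90S6CompactFactorOrbitalDrop   -- ★ U1B p864945: `mem_centralizer_prod_singleton_iff_of_mem_center`, `conj_prod_eq_of_mem_center`, `exists_homeomorph_quotient_centralizer_prod_of_mem_center`, `classOrbitalIntegral_comp_fst_eq_orbitalIntegral_map_symm`, `orbitalIntegral_prod_tensor_map_eq_of_mem_center`
import Literature.MeasureTheory.Group.InvariantQuotientBlockDescent                   -- ★ `exists_smul_map_block_quotientMeasure` (the block descent of ★ `quotientMeasure` with its scalar PINNED)
import Literature.NumberTheory.Automorphic.OrbitalMeasureCanonicalAtPoint              -- ★ `IsCanonical.classOrbitalIntegral_mk_eq_orbitalIntegral` (canonical family read at ANY representative); brings ★ `IsCanonical`, `compactCore`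
import Literature.NumberTheory.Automorphic.CompactCoreLevelPoint                       -- ★ `IsCanonical.atPoint_eq_quotientMeasure` (a normalised torus measure AT the point)
import Literature.NumberTheory.Automorphic.ClosedCompactDecomposition                  -- ★ `isMulRightInvariant_of_compactSpace`, `isInvInvariant_of_compactSpace` (Haar on a compact group)
import HarnessLib

/-!
# R90 · S6 «Ch. 14.1–14.5 stable trace formula» — CARD U1B FILE 2 (DAG row E1.3.7.2): THE COMPACT-FACTOR DROP FOR CANONICAL ORBITAL MEASURES,
# EXACT AT EVERY PINNED CLASS: `Φ(⟦(γ₁, a)⟧, f₁ ∘ pr₁; m_H) = ν₂(G₂) · Φ(⟦γ₁⟧, f₁; m₁)` (`Theorems/R90S6CompactFactorCanonicalDrop.lean`)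

Dealer R90-C14-plan (g2), :20 REPORT 2026-09-05T03:19:23Z «U1B ★ → F2 p01».  ★ U1B (`R90S6CompactFactorOrbitalDrop`, p864945) drops a central factor with the
orbital measure a PARAMETER: `O_γ^{μ}(f₁ ∘ fst) = O_{γ.1}^{(e⁻¹)_* μ}(f₁)`.  THIS FILE identifies `(e⁻¹)_* μ` when `μ` is the CANONICAL orbital measure of the tree
(★ `OrbitalMeasureFamily.IsCanonical`: at a pinned class the member is `ν ∕ t`, ★ `quotientMeasure`, `t` THE inversion-invariant Haar measure on the centraliser
with mass one on its compact core) — at EVERY pinned class, with the EXPLICIT constant.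

TREE SEARCH (the point of the card).  ★ `Literature/NumberTheory/Automorphic/OrbitalIntegralCompactFactorCanonical.lean` (P3a «PAIR for canonical families») has
(i) `IsCanonical.classOrbitalIntegral_comp_fst_eq_of_compactSpace` — EXACT, but only at an ELLIPTIC `γ₁` (compact `C(γ₁)`: every centraliser in sight is compact and the
members are push-forwards of Haar measure) and for CONTINUOUS `f`; (ii) `IsCanonical.exists_classOrbitalIntegral_comp_fst_eq_smul(_of_haar)` — any pinned class, but
`∃ c ≠ 0` UNNAMED (Gelbart's (10.19) up to a constant, ★ `exists_integral_descConj_eq_smul_mul`; «enough to transport VANISHING»).  The Hecke fundamental lemma on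
`H_w = U(2) × U(1)` (DAG E1.3.7.2 → E1.3.7.1) needs VALUES at the hyperbolic classes of `U(2)_w` (split torus, NON-compact centraliser) as well.  Here: the exact constant
`c = ν₂(G₂)` at every pinned class, for every Banach-valued `f₁` (no continuity, no integrability), by the block descent of the quotient measure with its scalar PINNED
(★ `InvariantQuotientBlockDescent.exists_smul_map_block_quotientMeasure`, block `eM = refl`, `T = C(γ)`, `A = C(γ.1)`, `Ψ = e⁻¹`) evaluated on
(positive compact) × (compact core) × `G₂`.

THE MATHEMATICS [Rogawski1990 §4.3 (4.3.1) p. 43, L. 4.9.3 p. 56; DeitmarEchterhoff2014 Thm. 1.5.3; Folland1995 §2.6 (2.52)].  `G₁`, `G₂` second countable locally compact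
groups, `G₂` COMPACT, `γ ∈ G₁ × G₂` with `γ.2` central (so `C(γ) = C(γ.1) × G₂`, ★ U1B), Haar measures `ν₁`, `ν₂`, `ν_H = ν₁ ⊗ ν₂`.  For the normalised Haar measures `t` on
`C(γ)` and `t₁` on `C(γ.1)` (mass one on the compact cores) and U1B's `e : G₁ ⧸ C(γ.1) ≃ₜ (G₁ × G₂) ⧸ C(γ)`:
**`(e⁻¹)_* (ν_H ∕ t) = ν₂(G₂) • (ν₁ ∕ t₁)`** (§2 HEAD) — the block descent gives `(e⁻¹)_* (ν_H ∕ t) = c • (ν₁ ∕ t₁)` with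
`c · t{s : s.1 ∈ E′, s.2 ∈ F} · ν₁(E) = ν_H(E × F) · t₁(E′)`; at `E′ =` compact core of `C(γ.1)`, `F = G₂`: `{s ∈ C(γ) : s.1 ∈ compactCore C(γ.1)}` IS the compact core of
`C(γ) ≅ C(γ.1) × G₂` (§1: projections ∕ preimages of compact subgroups, `G₂` compact), so both torus factors are `1` and `c · ν₁(E) = ν₁(E) ν₂(G₂)`.  Hence (§3) for a
canonical family `m_H` on `H = G₁ × G₂`: `(e⁻¹)_* (m_H c) = ν₂(G₂) • (ν₁ ∕ t₁)` for ANY normalised `t₁` at `(out c).1`, `Φ(c, f₁ ∘ pr₁; m_H) = ν₂(G₂) · O_{(out c).1}^{ν₁ ∕ t₁}(f₁)`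
(★ U1B family form), and for a canonical family `m₁` on `G₁`: **`Φ(⟦(γ₁, a)⟧, f₁ ∘ pr₁; m_H) = ν₂(G₂) · Φ(⟦γ₁⟧, f₁; m₁)`** at every pinned class, `a` central (★
`atPoint_eq_quotientMeasure` supplies the normalised torus measure at the point, ★ `classOrbitalIntegral_mk_eq_orbitalIntegral` reads `m₁` there) — `= Φ(⟦γ₁⟧, f₁; m₁)` for the
Haar probability `ν₂`; and the `ξ ⊗ χ` form `= ν₂(G₂) · Φ(⟦γ₁⟧, ξ; m₁) · χ(a)`.  §4: the CM edition `G₂ = U(Φ₁)(L⁺_v)` (compact at a non-split place, ★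
`compactSpace_cmDatum_local_one_of_smul_eq` — taken as an instance binder; centrality automatic, ★ U1B `mem_center_cmLocal_one`).

* §1 `setOf_fst_mem_compactCore_eq_compactCore_of_mem_center`.
* §2 **`map_symm_quotientMeasure_centralizer_eq_smul_of_mem_center`** (HEAD).
* §3 `map_symm_apply_eq_smul_quotientMeasure_of_isCanonical`, **`classOrbitalIntegral_comp_fst_eq_smul_orbitalIntegral_of_isCanonical`**,
  **`classOrbitalIntegral_comp_fst_mk_eq_smul_of_isCanonical`**, `classOrbitalIntegral_comp_fst_mk_eq_of_isCanonical` (`ν₂(G₂) = 1`),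
  `classOrbitalIntegral_tensor_mk_eq_smul_of_isCanonical`.
* §4 `classOrbitalIntegral_comp_fst_mk_eq_smul_of_isCanonical_cmLocalH`, `classOrbitalIntegral_comp_fst_mk_eq_of_isCanonical_cmLocalH`.

Cell `hodgecm-mathlib`, crux H413 (`stmt-HodgeConjecture-24833`), route of record `HCCMUnconditional`; programme R90-TF (brief `director/R90-BRIEF.v2.md` 1f40d54518340a35),
section S6 (base `R90-C14`), seat R90-C14-p01 (g3).  Lane `--kind proof --supports stmt-HodgeConjecture-24833 --as helper`; THEOREMS ONLY (no definition, no instance, no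
notation, no named fact, no kit, no `sorry`); imports ★ U1B + ★ `InvariantQuotientBlockDescent` + ★ `OrbitalMeasureCanonicalAtPoint` + ★ `CompactCoreLevelPoint` + ★
`ClosedCompactDecomposition` + HarnessLib; never `Lines/`.  HONEST LABEL: measure-theoretic pairing of canonical orbital measures, count-neutral until the E1.3.7.2 ∕ E1.3.9
consumer uses it; proves no printed global statement, discharges no citation; HC_CM is proved only modulo the 7 printed citations (2 remaining named inputs: hLiu418 =
stmt-HodgeConjecture-24832, h413 = stmt-HodgeConjecture-24833) until rung 0 closes.

## References
* [Rogawski1990] J. D. Rogawski, *Automorphic Representations of Unitary Groups in Three Variables*, Ann. of Math. Stud. 123 (1990): §4.3 (4.3.1) p. 43 (compatible measures on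
  `H_{γ_H}`, `G_γ`), L. 4.9.3 p. 56 (`C = U(1)³` compact), §4.9 p. 54, §1.7 p. 6 (measure conventions).
* [DeitmarEchterhoff2014] A. Deitmar, S. Echterhoff, *Principles of Harmonic Analysis*, 2nd ed. (2014), Thm. 1.5.3, Cor. 1.5.4.
* [Folland1995] G. B. Folland, *A Course in Abstract Harmonic Analysis* (1995), §2.2 (Haar uniqueness), §2.6 Thm. 2.49, (2.52).
* [Gelbart1975] S. Gelbart, *Automorphic forms on adele groups*, Ann. of Math. Stud. 83 (1975), p. 155 (10.19).
-/

set_option autoImplicit false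
-- the mandated namespace repeats the single-problem summit's segment (`HodgeConjecture.HodgeConjecture`)
set_option linter.dupNamespace false

noncomputable section

open MeasureTheory Measure Set Function Filter Topology
open scoped ENNReal NNReal
open Literature.MeasureTheory.Group Literature.NumberTheory.Automorphic Literature.NumberTheory.Rogawski1990

namespace Summit.HodgeConjecture.HodgeConjecture.R90.S6

/-! ## §1 The compact core of `C(γ) = C(γ.1) × G₂` for `G₂` compact -/

section CompactCore

variable {G₁ G₂ : Type*} [Group G₁] [Group G₂] [TopologicalSpace G₁] [TopologicalSpace G₂]
  [IsTopologicalGroup G₁] [IsTopologicalGroup G₂] [T2Space G₁] [T2Space G₂] [CompactSpace G₂]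

/-- **The compact core of `C(γ)` for `γ.2` central and `G₂` compact is `{s ∈ C(γ) : s.1 ∈ compactCore C(γ.1)}`** (read through `C(γ) = C(γ.1) × G₂`, ★ U1B; spelled
as the set the pinning clause of ★ `exists_smul_map_block_quotientMeasure` evaluates): a compact subgroup of `C(γ)` projects to a compact subgroup of `C(γ.1)`;
conversely `{s : s.1 ∈ K₁}` for a compact subgroup `K₁ ≤ C(γ.1)` is a subgroup of `C(γ)` whose carrier is the preimage of the compact `K₁ × G₂` under the closed embedding
`C(γ) ↪ G₁ × G₂`. [cite: DeitmarEchterhoff2014, Thm. 1.5.3] [cite: Rogawski1990, §1.7 p. 6] -/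
theorem setOf_fst_mem_compactCore_eq_compactCore_of_mem_center (γ : G₁ × G₂) (hγ : γ.2 ∈ Subgroup.center G₂) :
    {s : Subgroup.centralizer ({γ} : Set (G₁ × G₂)) |
        (s : G₁ × G₂).1 ∈ Subtype.val '' compactCore (Subgroup.centralizer ({γ.1} : Set G₁)) ∧ (s : G₁ × G₂).2 ∈ (Set.univ : Set G₂)} =
      compactCore (Subgroup.centralizer ({γ} : Set (G₁ × G₂))) := by
  -- the projection `θ : C(γ) →* C(γ.1)`, `s ↦ s.1`
  let θ : Subgroup.centralizer ({γ} : Set (G₁ × G₂)) →* Subgroup.centralizer ({γ.1} : Set G₁) :=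
    { toFun := fun s => ⟨(s : G₁ × G₂).1, (mem_centralizer_prod_singleton_iff_of_mem_center γ hγ _).1 s.2⟩
      map_one' := rfl
      map_mul' := fun _ _ => rfl }
  have hθ : Continuous θ := (continuous_fst.comp continuous_subtype_val).subtype_mk _
  have hθval : ∀ s, ((θ s : Subgroup.centralizer ({γ.1} : Set G₁)) : G₁) = (s : G₁ × G₂).1 := fun _ => rfl
  ext s
  simp only [Set.mem_setOf_eq, Set.mem_univ, and_true, mem_compactCore_iff, Set.mem_image]
  constructor
  · rintro ⟨k, ⟨K₁, hK₁, hk⟩, hks⟩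
    -- `K := θ⁻¹(K₁)`, compact as the preimage of `K₁ × G₂` under the closed embedding `C(γ) ↪ G₁ × G₂`
    refine ⟨K₁.comap θ, ?_, ?_⟩
    · have hset : ((K₁.comap θ : Subgroup (Subgroup.centralizer ({γ} : Set (G₁ × G₂)))) : Set (Subgroup.centralizer ({γ} : Set (G₁ × G₂)))) =
          Subtype.val ⁻¹' ((Subtype.val '' (K₁ : Set (Subgroup.centralizer ({γ.1} : Set G₁)))) ×ˢ (Set.univ : Set G₂)) := by
        ext x
        simp only [Subgroup.coe_comap, Set.mem_preimage, SetLike.mem_coe, Set.mem_prod, Set.mem_image, Set.mem_univ, and_true]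
        constructor
        · intro hx
          exact ⟨θ x, hx, rfl⟩
        · rintro ⟨y, hy, hyx⟩
          have : y = θ x := Subtype.ext (by rw [hθval]; exact hyx)
          rw [← this]
          exact hy
      rw [hset]
      exact (isClosed_coe_centralizer_singleton γ).isClosedEmbedding_subtypeVal.isCompact_preimage
        ((hK₁.image continuous_subtype_val).prod isCompact_univ)
    · rw [Subgroup.mem_comap]
      have : θ s = k := Subtype.ext (by rw [hθval]; exact hks.symm)
      rw [this]
      exact hk
  · rintro ⟨K, hK, hs⟩
    exact ⟨θ s, ⟨K.map θ, by rw [Subgroup.coe_map]; exact hK.image hθ, ⟨s, hs, rfl⟩⟩, rfl⟩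

end CompactCore

/-! ## §2 HEAD: `(e⁻¹)_* (ν_H ∕ t) = ν₂(G₂) • (ν₁ ∕ t₁)` for the normalised torus measures -/

section Head

variable {G₁ G₂ : Type*} [Group G₁] [Group G₂] [TopologicalSpace G₁] [TopologicalSpace G₂]
  [IsTopologicalGroup G₁] [IsTopologicalGroup G₂] [LocallyCompactSpace G₁] [LocallyCompactSpace G₂]
  [SecondCountableTopology G₁] [SecondCountableTopology G₂] [T2Space G₁] [T2Space G₂]
  [MeasurableSpace G₁] [BorelSpace G₁] [MeasurableSpace G₂] [BorelSpace G₂] [CompactSpace G₂]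

/-- **HEAD — THE CANONICAL COMPACT-FACTOR DROP.**  `G₂` compact, `γ.2` central, `e : G₁ ⧸ C(γ.1) ≃ₜ (G₁ × G₂) ⧸ C(γ)` with `e(x C(γ.1)) = (x, 1) C(γ)` (★ U1B), `t` on `C(γ)`
and `t₁` on `C(γ.1)` inversion-invariant Haar measures with MASS ONE ON THE COMPACT CORES, `ν₁`, `ν₂` Haar, `ν_H = ν₁ ⊗ ν₂`:
`(e⁻¹)_* (ν_H ∕ t) = ν₂(G₂) • (ν₁ ∕ t₁)`, i.e. `Measure.map e.symm (quotientMeasure C(γ) t _ ν_H) = ν₂ univ • quotientMeasure C(γ.1) t₁ _ ν₁`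
(★ `exists_smul_map_block_quotientMeasure` at the block `refl`, its scalar pinned on (positive compact) × (compact core, §1) × `G₂`).
[cite: DeitmarEchterhoff2014, Thm. 1.5.3] [cite: Folland1995, §2.6 (2.52)] [cite: Rogawski1990, §4.3 (4.3.1) p. 43] -/
theorem map_symm_quotientMeasure_centralizer_eq_smul_of_mem_center (γ : G₁ × G₂) (hγ : γ.2 ∈ Subgroup.center G₂)
    [MeasurableSpace (G₁ ⧸ Subgroup.centralizer ({γ.1} : Set G₁))] [BorelSpace (G₁ ⧸ Subgroup.centralizer ({γ.1} : Set G₁))]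
    [MeasurableSpace ((G₁ × G₂) ⧸ Subgroup.centralizer ({γ} : Set (G₁ × G₂)))]
    [BorelSpace ((G₁ × G₂) ⧸ Subgroup.centralizer ({γ} : Set (G₁ × G₂)))]
    (e : G₁ ⧸ Subgroup.centralizer ({γ.1} : Set G₁) ≃ₜ (G₁ × G₂) ⧸ Subgroup.centralizer ({γ} : Set (G₁ × G₂)))
    (he : ∀ x : G₁, e (QuotientGroup.mk x) = QuotientGroup.mk (x, 1))
    (t : Measure (Subgroup.centralizer ({γ} : Set (G₁ × G₂)))) [t.IsHaarMeasure] [t.IsInvInvariant]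
    (ht : t (compactCore (Subgroup.centralizer ({γ} : Set (G₁ × G₂)))) = 1)
    (t₁ : Measure (Subgroup.centralizer ({γ.1} : Set G₁))) [t₁.IsHaarMeasure] [t₁.IsInvInvariant]
    (ht₁ : t₁ (compactCore (Subgroup.centralizer ({γ.1} : Set G₁))) = 1)
    (ν₁ : Measure G₁) [ν₁.IsHaarMeasure] [ν₁.IsMulRightInvariant] (ν₂ : Measure G₂) [ν₂.IsHaarMeasure]
    (νH : Measure (G₁ × G₂)) [νH.IsHaarMeasure] [νH.IsMulRightInvariant] (hν : νH = ν₁.prod ν₂) :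
    Measure.map e.symm (quotientMeasure (Subgroup.centralizer ({γ} : Set (G₁ × G₂))) t (isClosed_coe_centralizer_singleton γ) νH) =
      (ν₂ Set.univ) • quotientMeasure (Subgroup.centralizer ({γ.1} : Set G₁)) t₁ (isClosed_coe_centralizer_singleton γ.1) ν₁ := by
  haveI : ν₂.IsMulRightInvariant := isMulRightInvariant_of_compactSpace ν₂
  haveI : ν₂.IsInvInvariant := isInvInvariant_of_compactSpace ν₂
  -- the block: `eM = refl`, `T = C(γ)`, `A = C(γ.1)`, `Ψ = e⁻¹`
  have hTA : ∀ g : G₁ × G₂, g ∈ Subgroup.centralizer ({γ} : Set (G₁ × G₂)) ↔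
      ((ContinuousMulEquiv.refl (G₁ × G₂)) g).1 ∈ Subgroup.centralizer ({γ.1} : Set G₁) :=
    fun g => mem_centralizer_prod_singleton_iff_of_mem_center γ hγ g
  have hΨ : ∀ b : G₁, e.symm.symm (QuotientGroup.mk b) = QuotientGroup.mk ((ContinuousMulEquiv.refl (G₁ × G₂)).symm (b, 1)) :=
    fun b => by rw [Homeomorph.symm_symm, he]; rfl
  obtain ⟨c, -, hmap, hpin⟩ := exists_smul_map_block_quotientMeasure (ContinuousMulEquiv.refl (G₁ × G₂))
    (Subgroup.centralizer ({γ} : Set (G₁ × G₂))) (isClosed_coe_centralizer_singleton γ) (Subgroup.centralizer ({γ.1} : Set G₁))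
    (isClosed_coe_centralizer_singleton γ.1) hTA e.symm hΨ t νH t₁ ν₁ ν₂
  -- pin the constant on `K₀ × compactCore × univ`
  obtain ⟨K₀⟩ := (inferInstance : Nonempty (TopologicalSpace.PositiveCompacts G₁))
  have hKpos : 0 < ν₁ K₀ := measure_pos_of_nonempty_interior ν₁ K₀.interior_nonempty
  have hKfin : ν₁ K₀ < ⊤ := K₀.isCompact.measure_lt_top
  have h := hpin (K₀ : Set G₁) (Subtype.val '' compactCore (Subgroup.centralizer ({γ.1} : Set G₁))) Set.univ
  have hset : {s : Subgroup.centralizer ({γ} : Set (G₁ × G₂)) |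
      ((ContinuousMulEquiv.refl (G₁ × G₂)) (s : G₁ × G₂)).1 ∈ Subtype.val '' compactCore (Subgroup.centralizer ({γ.1} : Set G₁)) ∧
        ((ContinuousMulEquiv.refl (G₁ × G₂)) (s : G₁ × G₂)).2 ∈ (Set.univ : Set G₂)} =
      compactCore (Subgroup.centralizer ({γ} : Set (G₁ × G₂))) :=
    setOf_fst_mem_compactCore_eq_compactCore_of_mem_center γ hγ
  have hpre : (ContinuousMulEquiv.refl (G₁ × G₂)) ⁻¹' ((K₀ : Set G₁) ×ˢ (Set.univ : Set G₂)) = (K₀ : Set G₁) ×ˢ (Set.univ : Set G₂) := rfl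
  rw [hset, ht, mul_one, hpre, Subtype.val_injective.preimage_image, ht₁, mul_one, hν,
    Measure.prod_prod, mul_comm (ν₁ K₀)] at h
  have hc : (c : ℝ≥0∞) = ν₂ Set.univ := (ENNReal.mul_left_inj hKpos.ne' hKfin.ne).1 h
  rw [hmap, ENNReal.smul_def, hc]

end Head

/-! ## §3 Canonical families: `(e⁻¹)_* (m_H c)` and the exact pairing at every pinned class -/

section Family

variable {G₁ G₂ : Type*} [Group G₁] [Group G₂] [TopologicalSpace G₁] [TopologicalSpace G₂]
  [IsTopologicalGroup G₁] [IsTopologicalGroup G₂] [LocallyCompactSpace G₁] [LocallyCompactSpace G₂]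
  [SecondCountableTopology G₁] [SecondCountableTopology G₂] [T2Space G₁] [T2Space G₂]
  [MeasurableSpace G₁] [BorelSpace G₁] [MeasurableSpace G₂] [BorelSpace G₂] [CompactSpace G₂]
  [∀ a : G₁, MeasurableSpace (G₁ ⧸ Subgroup.centralizer ({a} : Set G₁))]
  [∀ a : G₁, BorelSpace (G₁ ⧸ Subgroup.centralizer ({a} : Set G₁))]
  [∀ p : G₁ × G₂, MeasurableSpace ((G₁ × G₂) ⧸ Subgroup.centralizer ({p} : Set (G₁ × G₂)))]
  [∀ p : G₁ × G₂, BorelSpace ((G₁ × G₂) ⧸ Subgroup.centralizer ({p} : Set (G₁ × G₂)))]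
  {P : G₁ × G₂ → Prop} {νH : Measure (G₁ × G₂)} [νH.IsHaarMeasure] [νH.IsMulRightInvariant] {mH : OrbitalMeasureFamily (G₁ × G₂)}

/-- **A canonical member, pulled back along `e`**: `m_H` canonical for `(P, ν_H)`, `ν_H = ν₁ ⊗ ν₂`, `c` a `P`-class whose representative has central second component;
then for ANY inversion-invariant Haar `t₁` on `C((out c).1)` with mass one on the compact core, `(e⁻¹)_* (m_H c) = ν₂(G₂) • (ν₁ ∕ t₁)`.
[cite: Rogawski1990, §4.3 (4.3.1) p. 43] [cite: DeitmarEchterhoff2014, Thm. 1.5.3] -/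
theorem map_symm_apply_eq_smul_quotientMeasure_of_isCanonical (hm : mH.IsCanonical P νH)
    (ν₁ : Measure G₁) [ν₁.IsHaarMeasure] [ν₁.IsMulRightInvariant] (ν₂ : Measure G₂) [ν₂.IsHaarMeasure] (hν : νH = ν₁.prod ν₂)
    (c : ConjClasses (G₁ × G₂)) (hc : P (Quotient.out c)) (hγ : (Quotient.out c : G₁ × G₂).2 ∈ Subgroup.center G₂)
    (e : G₁ ⧸ Subgroup.centralizer ({(Quotient.out c : G₁ × G₂).1} : Set G₁) ≃ₜ
      (G₁ × G₂) ⧸ Subgroup.centralizer ({(Quotient.out c : G₁ × G₂)} : Set (G₁ × G₂)))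
    (he : ∀ x : G₁, e (QuotientGroup.mk x) = QuotientGroup.mk (x, 1))
    (t₁ : Measure (Subgroup.centralizer ({(Quotient.out c : G₁ × G₂).1} : Set G₁))) [t₁.IsHaarMeasure] [t₁.IsInvInvariant]
    (ht₁ : t₁ (compactCore (Subgroup.centralizer ({(Quotient.out c : G₁ × G₂).1} : Set G₁))) = 1) :
    Measure.map e.symm (mH c) =
      (ν₂ Set.univ) • quotientMeasure (Subgroup.centralizer ({(Quotient.out c : G₁ × G₂).1} : Set G₁)) t₁
        (isClosed_coe_centralizer_singleton (Quotient.out c : G₁ × G₂).1) ν₁ := by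
  obtain ⟨t, htH, htI, htc, hmc⟩ := hm c hc
  rw [hmc]
  exact map_symm_quotientMeasure_centralizer_eq_smul_of_mem_center (Quotient.out c) hγ e he t htc t₁ ht₁ ν₁ ν₂ νH hν

/-- **Canonical H-side orbital integral of `f₁ ∘ pr₁` = `ν₂(G₂)` × the orbital integral of `f₁` at `(out c).1` against `ν₁ ∕ t₁`**, for ANY normalised `t₁`
(★ U1B family form `classOrbitalIntegral_comp_fst_eq_orbitalIntegral_map_symm` + HEAD); Banach-valued `f₁`, no continuity or integrability hypothesis.
[cite: Rogawski1990, §4.3 (4.3.1) p. 43; L. 4.9.3 p. 56] [cite: Gelbart1975, p. 155 (10.19)] -/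
theorem classOrbitalIntegral_comp_fst_eq_smul_orbitalIntegral_of_isCanonical (hm : mH.IsCanonical P νH)
    (ν₁ : Measure G₁) [ν₁.IsHaarMeasure] [ν₁.IsMulRightInvariant] (ν₂ : Measure G₂) [ν₂.IsHaarMeasure] (hν : νH = ν₁.prod ν₂)
    (c : ConjClasses (G₁ × G₂)) (hc : P (Quotient.out c)) (hγ : (Quotient.out c : G₁ × G₂).2 ∈ Subgroup.center G₂)
    (t₁ : Measure (Subgroup.centralizer ({(Quotient.out c : G₁ × G₂).1} : Set G₁))) [t₁.IsHaarMeasure] [t₁.IsInvInvariant]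
    (ht₁ : t₁ (compactCore (Subgroup.centralizer ({(Quotient.out c : G₁ × G₂).1} : Set G₁))) = 1)
    {E : Type*} [NormedAddCommGroup E] [NormedSpace ℝ E] (f₁ : G₁ → E) :
    classOrbitalIntegral mH (f₁ ∘ Prod.fst) c =
      (ν₂ Set.univ).toReal • orbitalIntegral (Quotient.out c : G₁ × G₂).1 f₁
        (quotientMeasure (Subgroup.centralizer ({(Quotient.out c : G₁ × G₂).1} : Set G₁)) t₁
          (isClosed_coe_centralizer_singleton (Quotient.out c : G₁ × G₂).1) ν₁) := by
  obtain ⟨h, h1, -⟩ := exists_homeomorph_quotient_centralizer_prod_of_mem_center (Quotient.out c : G₁ × G₂) hγ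
  have h1' : ∀ x : G₁, h.toMeasurableEquiv (QuotientGroup.mk x) = QuotientGroup.mk (x, 1) := fun x => by
    rw [Homeomorph.toMeasurableEquiv_coe, h1]
  rw [classOrbitalIntegral_comp_fst_eq_orbitalIntegral_map_symm mH c h.toMeasurableEquiv h1' f₁, Homeomorph.toMeasurableEquiv_symm_coe,
    map_symm_apply_eq_smul_quotientMeasure_of_isCanonical hm ν₁ ν₂ hν c hc hγ h h1 t₁ ht₁, orbitalIntegral_smul_measure]

variable {P₁ : G₁ → Prop} {m₁ : OrbitalMeasureFamily G₁}

/-- **EXACT PAIR FOR CANONICAL FAMILIES AT EVERY PINNED CLASS.**  `G₂` compact, `m_H` canonical for `(P, ν_H)` with `ν_H = ν₁ ⊗ ν₂`, `m₁` canonical for `(P₁, ν₁)`;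
at a point `(γ₁, a)` with `a` central and pinned classes (`P (out ⟦(γ₁, a)⟧)`, `P₁ (out ⟦γ₁⟧)`), for EVERY `f₁ : G₁ → E`:
`Φ(⟦(γ₁, a)⟧, f₁ ∘ pr₁; m_H) = ν₂(G₂) · Φ(⟦γ₁⟧, f₁; m₁)` — the binders of ★ `IsCanonical.classOrbitalIntegral_comp_fst_eq_of_compactSpace` WITHOUT `C(γ₁)` compact and
WITHOUT continuity, and the constant of ★ `IsCanonical.exists_classOrbitalIntegral_comp_fst_eq_smul` made explicit (`a` central: automatic for abelian `G₂ = U(1)_w`).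
[cite: Rogawski1990, §4.3 (4.3.1) p. 43; L. 4.9.3 p. 56] [cite: Gelbart1975, p. 155 (10.19)] [cite: DeitmarEchterhoff2014, Thm. 1.5.3] -/
theorem classOrbitalIntegral_comp_fst_mk_eq_smul_of_isCanonical (hm : mH.IsCanonical P νH)
    (ν₁ : Measure G₁) [ν₁.IsHaarMeasure] [ν₁.IsMulRightInvariant] (ν₂ : Measure G₂) [ν₂.IsHaarMeasure] (hν : νH = ν₁.prod ν₂)
    (hm₁ : m₁.IsCanonical P₁ ν₁) (γ₁ : G₁) (a : G₂) (ha : a ∈ Subgroup.center G₂)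
    (hc : P (Quotient.out (ConjClasses.mk (γ₁, a)))) (hc₁ : P₁ (Quotient.out (ConjClasses.mk γ₁)))
    {E : Type*} [NormedAddCommGroup E] [NormedSpace ℝ E] (f₁ : G₁ → E) :
    classOrbitalIntegral mH (f₁ ∘ Prod.fst) (ConjClasses.mk (γ₁, a)) = (ν₂ Set.univ).toReal • classOrbitalIntegral m₁ f₁ (ConjClasses.mk γ₁) := by
  -- the representative `out ⟦(γ₁, a)⟧ = z (γ₁, a) z⁻¹ = (z.1 γ₁ z.1⁻¹, a)`
  obtain ⟨z, hz⟩ := isConj_iff.1 (ConjClasses.mk_eq_mk_iff_isConj.1 (Quotient.out_eq (ConjClasses.mk (γ₁, a))).symm)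
  have hq : (Quotient.out (ConjClasses.mk (γ₁, a)) : G₁ × G₂) = (z.1 * γ₁ * z.1⁻¹, a) := by
    rw [← hz]; exact conj_prod_eq_of_mem_center (γ₁, a) ha z
  have hγ : (Quotient.out (ConjClasses.mk (γ₁, a)) : G₁ × G₂).2 ∈ Subgroup.center G₂ := by rw [hq]; exact ha
  have hmk₁ : ConjClasses.mk (Quotient.out (ConjClasses.mk (γ₁, a)) : G₁ × G₂).1 = ConjClasses.mk γ₁ := by
    rw [hq]; exact ConjClasses.mk_eq_mk_iff_isConj.2 (isConj_iff.2 ⟨z.1, rfl⟩).symm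
  have hc₁' : P₁ (Quotient.out (ConjClasses.mk (Quotient.out (ConjClasses.mk (γ₁, a)) : G₁ × G₂).1)) := by rw [hmk₁]; exact hc₁
  -- a normalised inversion-invariant Haar measure on `C((out c).1)` (from `m₁`, read at the point)
  obtain ⟨t₁, ht₁H, ht₁I, ht₁c, -⟩ := hm₁.atPoint_eq_quotientMeasure (Quotient.out (ConjClasses.mk (γ₁, a)) : G₁ × G₂).1 hc₁'
  rw [classOrbitalIntegral_comp_fst_eq_smul_orbitalIntegral_of_isCanonical hm ν₁ ν₂ hν _ hc hγ t₁ ht₁c f₁,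
    ← hm₁.classOrbitalIntegral_mk_eq_orbitalIntegral hc₁' t₁ ht₁c f₁, hmk₁]

/-- **… and EQUALITY for the Haar probability on `G₂`** (`ν₂(G₂) = 1`): `Φ(⟦(γ₁, a)⟧, f₁ ∘ pr₁; m_H) = Φ(⟦γ₁⟧, f₁; m₁)` at every pinned class.
[cite: Rogawski1990, §4.3 (4.3.1) p. 43; L. 4.9.3 p. 56] [cite: Gelbart1975, p. 155 (10.19)] -/
theorem classOrbitalIntegral_comp_fst_mk_eq_of_isCanonical (hm : mH.IsCanonical P νH)
    (ν₁ : Measure G₁) [ν₁.IsHaarMeasure] [ν₁.IsMulRightInvariant] (ν₂ : Measure G₂) [ν₂.IsHaarMeasure] (hν : νH = ν₁.prod ν₂)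
    (hν₂ : ν₂ Set.univ = 1) (hm₁ : m₁.IsCanonical P₁ ν₁) (γ₁ : G₁) (a : G₂) (ha : a ∈ Subgroup.center G₂)
    (hc : P (Quotient.out (ConjClasses.mk (γ₁, a)))) (hc₁ : P₁ (Quotient.out (ConjClasses.mk γ₁)))
    {E : Type*} [NormedAddCommGroup E] [NormedSpace ℝ E] (f₁ : G₁ → E) :
    classOrbitalIntegral mH (f₁ ∘ Prod.fst) (ConjClasses.mk (γ₁, a)) = classOrbitalIntegral m₁ f₁ (ConjClasses.mk γ₁) := by
  rw [classOrbitalIntegral_comp_fst_mk_eq_smul_of_isCanonical hm ν₁ ν₂ hν hm₁ γ₁ a ha hc hc₁ f₁, hν₂, ENNReal.toReal_one, one_smul]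

/-- **The `ξ ⊗ χ` form** (the `U(1)`-character bookkeeping of L. 4.9.3): for a complex factorizable `Φ` (`Φ(x, k) = ξ(x) χ(k)`) at a point `(γ₁, a)` with `a` central and
pinned classes, `Φ(⟦(γ₁, a)⟧, Φ; m_H) = ν₂(G₂) · Φ(⟦γ₁⟧, ξ; m₁) · χ(a)`. [cite: Rogawski1990, L. 4.9.3 p. 56] [cite: Gelbart1975, p. 155 (10.19)] -/
theorem classOrbitalIntegral_tensor_mk_eq_smul_of_isCanonical (hm : mH.IsCanonical P νH)
    (ν₁ : Measure G₁) [ν₁.IsHaarMeasure] [ν₁.IsMulRightInvariant] (ν₂ : Measure G₂) [ν₂.IsHaarMeasure] (hν : νH = ν₁.prod ν₂)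
    (hm₁ : m₁.IsCanonical P₁ ν₁) (γ₁ : G₁) (a : G₂) (ha : a ∈ Subgroup.center G₂)
    (hc : P (Quotient.out (ConjClasses.mk (γ₁, a)))) (hc₁ : P₁ (Quotient.out (ConjClasses.mk γ₁)))
    {Φ : G₁ × G₂ → ℂ} {ξ : G₁ → ℂ} {χ : G₂ → ℂ} (hΦ : ∀ x k, Φ (x, k) = ξ x * χ k) :
    classOrbitalIntegral mH Φ (ConjClasses.mk (γ₁, a)) = (ν₂ Set.univ).toReal • (classOrbitalIntegral m₁ ξ (ConjClasses.mk γ₁) * χ a) := by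
  obtain ⟨z, hz⟩ := isConj_iff.1 (ConjClasses.mk_eq_mk_iff_isConj.1 (Quotient.out_eq (ConjClasses.mk (γ₁, a))).symm)
  have hq : (Quotient.out (ConjClasses.mk (γ₁, a)) : G₁ × G₂) = (z.1 * γ₁ * z.1⁻¹, a) := by
    rw [← hz]; exact conj_prod_eq_of_mem_center (γ₁, a) ha z
  have hγ : (Quotient.out (ConjClasses.mk (γ₁, a)) : G₁ × G₂).2 ∈ Subgroup.center G₂ := by rw [hq]; exact ha
  have hq2 : (Quotient.out (ConjClasses.mk (γ₁, a)) : G₁ × G₂).2 = a := by rw [hq]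
  have hmk₁ : ConjClasses.mk (Quotient.out (ConjClasses.mk (γ₁, a)) : G₁ × G₂).1 = ConjClasses.mk γ₁ := by
    rw [hq]; exact ConjClasses.mk_eq_mk_iff_isConj.2 (isConj_iff.2 ⟨z.1, rfl⟩).symm
  have hc₁' : P₁ (Quotient.out (ConjClasses.mk (Quotient.out (ConjClasses.mk (γ₁, a)) : G₁ × G₂).1)) := by rw [hmk₁]; exact hc₁
  obtain ⟨t₁, ht₁H, ht₁I, ht₁c, -⟩ := hm₁.atPoint_eq_quotientMeasure (Quotient.out (ConjClasses.mk (γ₁, a)) : G₁ × G₂).1 hc₁'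
  obtain ⟨h, h1, -⟩ := exists_homeomorph_quotient_centralizer_prod_of_mem_center (Quotient.out (ConjClasses.mk (γ₁, a)) : G₁ × G₂) hγ
  have h1' : ∀ x : G₁, h.toMeasurableEquiv (QuotientGroup.mk x) = QuotientGroup.mk (x, 1) := fun x => by
    rw [Homeomorph.toMeasurableEquiv_coe, h1]
  rw [classOrbitalIntegral_eq, ← MeasurableEquiv.map_map_symm h.toMeasurableEquiv (ν := mH (ConjClasses.mk (γ₁, a))),
    orbitalIntegral_prod_tensor_map_eq_of_mem_center _ hγ h.toMeasurableEquiv h1' hΦ, Homeomorph.toMeasurableEquiv_symm_coe,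
    map_symm_apply_eq_smul_quotientMeasure_of_isCanonical hm ν₁ ν₂ hν _ hc hγ h h1 t₁ ht₁c, orbitalIntegral_smul_measure,
    ← hm₁.classOrbitalIntegral_mk_eq_orbitalIntegral hc₁' t₁ ht₁c ξ, hmk₁, hq2, smul_mul_assoc]

end Family

/-! ## §4 The CM edition: `H_v = U(Φ₂)(L⁺_v) × U(Φ₁)(L⁺_v)`, `U(Φ₁)(L⁺_v)` compact (non-split `v`), every element central -/

section CM

open NumberField IsDedekindDomain

variable (L : Type) [Field L] [NumberField L] [IsCMField L] (Φ₁ : Matrix (Fin 1) (Fin 1) L)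
  (v : HeightOneSpectrum (𝓞 ↥(maximalRealSubfield L)))
  {G₁ : Type*} [Group G₁] [TopologicalSpace G₁] [IsTopologicalGroup G₁] [LocallyCompactSpace G₁] [SecondCountableTopology G₁] [T2Space G₁]
  [MeasurableSpace G₁] [BorelSpace G₁]
  [MeasurableSpace ((UnitaryGroup.cmDatum L 1 Φ₁).Local v)] [BorelSpace ((UnitaryGroup.cmDatum L 1 Φ₁).Local v)]
  [CompactSpace ((UnitaryGroup.cmDatum L 1 Φ₁).Local v)]
  [∀ a : G₁, MeasurableSpace (G₁ ⧸ Subgroup.centralizer ({a} : Set G₁))]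
  [∀ a : G₁, BorelSpace (G₁ ⧸ Subgroup.centralizer ({a} : Set G₁))]
  [∀ p : G₁ × (UnitaryGroup.cmDatum L 1 Φ₁).Local v,
    MeasurableSpace ((G₁ × (UnitaryGroup.cmDatum L 1 Φ₁).Local v) ⧸ Subgroup.centralizer ({p} : Set (G₁ × (UnitaryGroup.cmDatum L 1 Φ₁).Local v)))]
  [∀ p : G₁ × (UnitaryGroup.cmDatum L 1 Φ₁).Local v,
    BorelSpace ((G₁ × (UnitaryGroup.cmDatum L 1 Φ₁).Local v) ⧸ Subgroup.centralizer ({p} : Set (G₁ × (UnitaryGroup.cmDatum L 1 Φ₁).Local v)))]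
  {P : G₁ × (UnitaryGroup.cmDatum L 1 Φ₁).Local v → Prop} {νH : Measure (G₁ × (UnitaryGroup.cmDatum L 1 Φ₁).Local v)}
  [νH.IsHaarMeasure] [νH.IsMulRightInvariant] {mH : OrbitalMeasureFamily (G₁ × (UnitaryGroup.cmDatum L 1 Φ₁).Local v)}
  {P₁ : G₁ → Prop} {m₁ : OrbitalMeasureFamily G₁}

/-- **(CM edition) EXACT PAIR on `G₁ × U(Φ₁)(L⁺_v)`** (`G₁` any second countable locally compact group — e.g. `U(Φ₂)(L⁺_v)` or a standard model — `U(Φ₁)(L⁺_v)`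
compact, as at a non-split place, ★ `compactSpace_cmDatum_local_one_of_smul_eq`): for `m_H` canonical for `(P, ν_H = ν₁ ⊗ ν₂)` and `m₁` canonical for `(P₁, ν₁)`, at EVERY
`(γ₁, a)` with pinned classes, `Φ(⟦(γ₁, a)⟧, f₁ ∘ pr₁; m_H) = ν₂(U(Φ₁)(L⁺_v)) · Φ(⟦γ₁⟧, f₁; m₁)` (centrality of `a` is automatic, ★ U1B `mem_center_cmLocal_one`).
[cite: Rogawski1990, §4.3 (4.3.1) p. 43; L. 4.9.3 p. 56; §4.8 Case (a) p. 53] -/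
theorem classOrbitalIntegral_comp_fst_mk_eq_smul_of_isCanonical_cmLocalH (hm : mH.IsCanonical P νH)
    (ν₁ : Measure G₁) [ν₁.IsHaarMeasure] [ν₁.IsMulRightInvariant] (ν₂ : Measure ((UnitaryGroup.cmDatum L 1 Φ₁).Local v)) [ν₂.IsHaarMeasure]
    (hν : νH = ν₁.prod ν₂) (hm₁ : m₁.IsCanonical P₁ ν₁) (γ₁ : G₁) (a : (UnitaryGroup.cmDatum L 1 Φ₁).Local v)
    (hc : P (Quotient.out (ConjClasses.mk (γ₁, a)))) (hc₁ : P₁ (Quotient.out (ConjClasses.mk γ₁)))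
    {E : Type*} [NormedAddCommGroup E] [NormedSpace ℝ E] (f₁ : G₁ → E) :
    classOrbitalIntegral mH (f₁ ∘ Prod.fst) (ConjClasses.mk (γ₁, a)) = (ν₂ Set.univ).toReal • classOrbitalIntegral m₁ f₁ (ConjClasses.mk γ₁) :=
  classOrbitalIntegral_comp_fst_mk_eq_smul_of_isCanonical hm ν₁ ν₂ hν hm₁ γ₁ a (mem_center_cmLocal_one L Φ₁ v a) hc hc₁ f₁

/-- **(CM edition) EQUALITY for the Haar probability** `ν₂(U(Φ₁)(L⁺_v)) = 1` (the tree's pin `ν_H(K_{H,v}) = 1` with `K_{H,v} = K₂ × U(Φ₁)(L⁺_v)` and `ν₁(K₂) = 1`):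
`Φ(⟦(γ₁, a)⟧, f₁ ∘ pr₁; m_H) = Φ(⟦γ₁⟧, f₁; m₁)` at every pinned class. [cite: Rogawski1990, §4.3 (4.3.1) p. 43; L. 4.9.3 p. 56] -/
theorem classOrbitalIntegral_comp_fst_mk_eq_of_isCanonical_cmLocalH (hm : mH.IsCanonical P νH)
    (ν₁ : Measure G₁) [ν₁.IsHaarMeasure] [ν₁.IsMulRightInvariant] (ν₂ : Measure ((UnitaryGroup.cmDatum L 1 Φ₁).Local v)) [ν₂.IsHaarMeasure]
    (hν : νH = ν₁.prod ν₂) (hν₂ : ν₂ Set.univ = 1) (hm₁ : m₁.IsCanonical P₁ ν₁) (γ₁ : G₁) (a : (UnitaryGroup.cmDatum L 1 Φ₁).Local v)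
    (hc : P (Quotient.out (ConjClasses.mk (γ₁, a)))) (hc₁ : P₁ (Quotient.out (ConjClasses.mk γ₁)))
    {E : Type*} [NormedAddCommGroup E] [NormedSpace ℝ E] (f₁ : G₁ → E) :
    classOrbitalIntegral mH (f₁ ∘ Prod.fst) (ConjClasses.mk (γ₁, a)) = classOrbitalIntegral m₁ f₁ (ConjClasses.mk γ₁) :=
  classOrbitalIntegral_comp_fst_mk_eq_of_isCanonical hm ν₁ ν₂ hν hν₂ hm₁ γ₁ a (mem_center_cmLocal_one L Φ₁ v a) hc hc₁ f₁

end CM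

end Summit.HodgeConjecture.HodgeConjecture.R90.S6

end
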